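import Summits.QuantumFields.YangMills.Theorems.BalabanLadderUVTorusClassDefs
import Summits.QuantumFields.YangMills.Theorems.BalabanLadderUVTorusDictionary

/-!
# Route `BalabanLadder`, junction currency on classes of raw torus sides — kernels (D-0061 certificates)

For the vocabulary of `Theorems/BalabanLadderUVTorusClassDefs.lean` (owner ruling (c′) of 2026-08-26T18:17:23Z):
* §1 **at the ODD class the class-parametric legs ARE the spine's literal legs**: `MomentBounds6OnSides G r a {M | Odd M} ↔ MomentBounds6 G r a`,
  `GapInUnitsOnSides G r a {M | Odd M} ↔ GapInUnits G r a` (so a re-typed spine keeps today's legs as the instance `𝓣 = odd`); antitonicity in `𝓣`;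
* §2 **on Track A's class the raw-torus expectation IS Bałaban's expectation**: `torusEOn (SU N) (fundamentalLatticeRep N) β ((F.P K).sitesPerDir 0) Φ
  = Missing.expect (F.P K) (N·β) (Φ ∘ torusLift ∘ toConfig)` and the plane-string integrand of `MomentBounds6OnSides … familySides` in Track A's
  symbols (`TorusDictionary` §2/§5);
* §3 `familySides` is unbounded (witness: block size 13), all even, and disjoint from the odd class (the junction fact, class form).
HONEST FRAMING: identities and bookkeeping; nothing is asserted about E0′ or the infrared leg; not a gap, not Clay.
-/

set_option autoImplicit false

open MeasureTheory Filter Topology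
open Literature.MathematicalPhysics.QuantumFieldTheory
open Literature.MathematicalPhysics.QuantumFieldTheory.Balaban1983to89
open Literature.MathematicalPhysics.QuantumFieldTheory.Balaban1983to89.T4Continuum
open Literature.MathematicalPhysics.QuantumLattice (fundamentalLatticeRep LGConfig torusLift)
open Summit.QuantumFields.YangMills.Cruxes.OSLegsFromFemtoAndGap.DlrCollarTransfer (plane MomentBounds6 GapInUnits)
open Summit.QuantumFields.YangMills.Cruxes.UV.TorusDictionary

namespace Summit.QuantumFields.YangMills.Cruxes.UV.TorusClass

/-! ## §1 The odd class is the spine's literal currency -/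

section Odd

variable {G : Type} [Group G] [TopologicalSpace G] [IsTopologicalGroup G] [CompactSpace G]
  [MeasurableSpace G] [BorelSpace G] (r : LatticeRep G) (a : ℝ → ℝ)

/-- `torusE G r β S` is `torusEOn G r β (2S+1)` (definitionally). [folklore] -/
theorem torusEOn_two_mul_add_one (β : ℝ) (S : ℕ) (Φ : LGConfig 4 G → ℝ) :
    torusEOn G r β (2 * S + 1) Φ =
      Summit.QuantumFields.YangMills.Cruxes.OSLegsFromFemtoAndGap.DlrCollarTransfer.torusE G r β S Φ := rfl

/-- **D-0061 AT THE ODD CLASS (ceilings)**: the class-parametric ceilings on the odd raw sides are EXACTLY the spine's `MomentBounds6 G r a`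
(same constants; `8R+16 ≤ 2S+1 ↔ 4R+8 ≤ S`). [folklore] -/
theorem momentBounds6OnSides_odd_iff :
    MomentBounds6OnSides G r a {M | Odd M} ↔ MomentBounds6 G r a := by
  constructor
  · rintro ⟨C, β₄, ℓ₄, hℓ₄, hC, H⟩
    refine ⟨C, β₄, ℓ₄, hℓ₄, hC, fun β hβ S n q x R hq hR hRa hRS hsep => ?_⟩
    exact H β hβ (2 * S + 1) ⟨S, rfl⟩ n q x R hq hR hRa (by omega) hsep
  · rintro ⟨C, β₄, ℓ₄, hℓ₄, hC, H⟩
    refine ⟨C, β₄, ℓ₄, hℓ₄, hC, fun β hβ M _ hM n q x R hq hR hRa hRM hsep => ?_⟩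
    obtain ⟨S, rfl⟩ := hM
    exact H β hβ S n q x R hq hR hRa (by omega) hsep

/-- **D-0061 AT THE ODD CLASS (lattice gap)**: the class-parametric lattice gap on the odd raw sides is EXACTLY the spine's `GapInUnits G r a`
(thresholds `M₁ = 2S₁+1 ∕ S₁ = M₁`; `2n+1 ≤ 2S+1 ↔ n ≤ S`). [folklore] -/
theorem gapInUnitsOnSides_odd_iff :
    GapInUnitsOnSides G r a {M | Odd M} ↔ GapInUnits G r a := by
  constructor
  · rintro ⟨c₁, β₂, M₁, hc₁, H⟩
    refine ⟨c₁, β₂, M₁, hc₁, fun A B => ?_⟩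
    obtain ⟨C, hC⟩ := H A B
    refine ⟨C, fun β hβ S n hS hn => ?_⟩
    exact hC β hβ (2 * S + 1) ⟨S, rfl⟩ (by omega) n (by omega)
  · rintro ⟨c₁, β₂, S₁, hc₁, H⟩
    refine ⟨c₁, β₂, fun β => 2 * S₁ β + 1, hc₁, fun A B => ?_⟩
    obtain ⟨C, hC⟩ := H A B
    refine ⟨C, fun β hβ M _ hM hM₁ n hn => ?_⟩
    obtain ⟨S, rfl⟩ := hM
    have hM₁' : 2 * S₁ β + 1 ≤ 2 * S + 1 := hM₁
    exact hC β hβ S n (by omega) (by omega)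

/-- The ceilings on a class restrict to any subclass. [folklore] -/
theorem momentBounds6OnSides_mono {𝓣 𝓣' : Set ℕ} (h𝓣 : 𝓣' ⊆ 𝓣) (h : MomentBounds6OnSides G r a 𝓣) :
    MomentBounds6OnSides G r a 𝓣' := by
  obtain ⟨C, β₄, ℓ₄, hℓ₄, hC, H⟩ := h
  exact ⟨C, β₄, ℓ₄, hℓ₄, hC, fun β hβ M _ hM => H β hβ M (h𝓣 hM)⟩

/-- The lattice gap on a class restricts to any subclass. [folklore] -/
theorem gapInUnitsOnSides_mono {𝓣 𝓣' : Set ℕ} (h𝓣 : 𝓣' ⊆ 𝓣) (h : GapInUnitsOnSides G r a 𝓣) :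
    GapInUnitsOnSides G r a 𝓣' := by
  obtain ⟨c₁, β₂, M₁, hc₁, H⟩ := h
  refine ⟨c₁, β₂, M₁, hc₁, fun A B => ?_⟩
  obtain ⟨C, hC⟩ := H A B
  exact ⟨C, fun β hβ M _ hM => hC β hβ M (h𝓣 hM)⟩

/-- **The ceilings move to any eventually coarser unit on every class** (mirror of `UVSeamRec.CeilingsTransfer.momentBounds6_of_eventually_le`,
the E0′ unit glue `a_B → uRec`, now class-parametric). [folklore] -/
theorem momentBounds6OnSides_of_eventually_le {𝓣 : Set ℕ} {a u : ℝ → ℝ} {c : ℝ} (hc : 0 < c)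
    (hle : ∀ᶠ β in atTop, a β ≤ c * u β) (h : MomentBounds6OnSides G r a 𝓣) : MomentBounds6OnSides G r u 𝓣 := by
  obtain ⟨C, β₄, ℓ₄, hℓ₄, hC, H⟩ := h
  obtain ⟨β₀, hβ₀⟩ := Filter.eventually_atTop.1 hle
  refine ⟨C, max β₄ β₀, ℓ₄ / c, div_pos hℓ₄ hc, hC, fun β hβ M _ hM n q x R hq hR hRu hRM hsep => ?_⟩
  have hβ₄ : β₄ ≤ β := (le_max_left _ _).trans hβ
  have hau : a β ≤ c * u β := hβ₀ β ((le_max_right _ _).trans hβ)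
  refine H β hβ₄ M hM n q x R hq hR ?_ hRM hsep
  rw [le_div_iff₀ hc] at hRu
  have hR0 : (0 : ℝ) ≤ R := Nat.cast_nonneg R
  calc (R : ℝ) * a β ≤ R * (c * u β) := mul_le_mul_of_nonneg_left hau hR0
    _ = R * u β * c := by ring
    _ ≤ ℓ₄ := hRu

end Odd

/-! ## §2 Track A's class: the raw-torus expectation IS Bałaban's expectation -/

/-- **On a family side the raw-torus expectation is a Bałaban expectation**: for host coupling `β ≥ 0`,
`torusEOn (SU N) (fundamentalLatticeRep N) β ((F.P K).sitesPerDir 0) Φ = ⟨Φ ∘ torusLift M ∘ toConfig⟩_{F.P K, N·β}` (Bałaban's normalised-trace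
coupling is `N` times the host coupling). [cite: Balaban1985UV3, (1)-(2) p.256] -/
theorem torusEOn_family_eq_expect {N : ℕ} [NeZero N] (F : T4Family) (K : ℕ) {β : ℝ} (hβ : 0 ≤ β)
    (Φ : LGConfig 4 (Matrix.specialUnitaryGroup (Fin N) ℂ) → ℝ) :
    torusEOn (Matrix.specialUnitaryGroup (Fin N) ℂ) (fundamentalLatticeRep N) β ((F.P K).sitesPerDir 0) Φ =
      Missing.expect (F.P K) ((N : ℝ) * β)
        (fun U : GaugeField (F.P K) 0 (Matrix.specialUnitaryGroup (Fin N) ℂ) =>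
          Φ (torusLift ((F.P K).sitesPerDir 0) (toConfig U))) := by
  have hN : (N : ℝ) ≠ 0 := Nat.cast_ne_zero.mpr (NeZero.ne N)
  have h := expect_family_torusLift_eq_wilsonExpectation F K (mul_nonneg (Nat.cast_nonneg N) hβ) Φ
  rw [mul_div_cancel_left₀ β hN] at h
  exact h.symm

/-- **The `MomentBounds6OnSides` integrand on a family side, in Track A's symbols**: for `β ≥ 0`, orientations `(q i).1 < (q i).2`, sites `x i`
and centrings `c i`: `torusEOn … M (∏ᵢ (plane (q i) (x i) − c i)) = ⟨∏ᵢ (N·reTr U(∂pᵢ) − c i)⟩_{F.P K, N·β}`, `M = (F.P K).sitesPerDir 0`,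
`pᵢ = (x i mod M; q i)`. [cite: Balaban1985Averaging, (9) p.19] -/
theorem torusEOn_family_planeString_eq_expect {N : ℕ} [NeZero N] (F : T4Family) (K : ℕ) {β : ℝ} (hβ : 0 ≤ β) {n : ℕ}
    (q : Fin n → Fin 4 × Fin 4) (hq : ∀ i, (q i).1 < (q i).2) (x : Fin n → (Fin 4 → ℤ)) (c : Fin n → ℝ) :
    torusEOn (Matrix.specialUnitaryGroup (Fin N) ℂ) (fundamentalLatticeRep N) β ((F.P K).sitesPerDir 0)
        (fun U => ∏ i, (plane (Matrix.specialUnitaryGroup (Fin N) ℂ) (fundamentalLatticeRep N) (q i) (x i) U - c i)) =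
      Missing.expect (F.P K) ((N : ℝ) * β)
        (fun U : GaugeField (F.P K) 0 (Matrix.specialUnitaryGroup (Fin N) ℂ) =>
          ∏ i, ((N : ℝ) * reTr (GaugeField.plaqHol U
            ⟨Literature.Probability.LatticeModels.Torus.proj ((F.P K).sitesPerDir 0) (x i), (q i).1, (q i).2, hq i⟩) - c i)) := by
  have hN : (N : ℝ) ≠ 0 := Nat.cast_ne_zero.mpr (NeZero.ne N)
  have h := integral_planeString_family_eq_expect (N := N) F K (mul_nonneg (Nat.cast_nonneg N) hβ) q hq x c
  rw [mul_div_cancel_left₀ β hN] at h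
  exact h

/-! ## §3 Track A's class in numbers: unbounded, even, disjoint from the odd class -/

/-- Every family side is even. [folklore] -/
theorem even_of_mem_familySides {M : ℕ} (hM : M ∈ familySides) : Even M := by
  obtain ⟨F, K, rfl⟩ := hM
  exact even_family_sitesPerDir F K 0

/-- **THE JUNCTION FACT, CLASS FORM**: Track A's class and the odd class (the spine's and the summit statement's tori) are disjoint. [folklore] -/
theorem not_odd_of_mem_familySides {M : ℕ} (hM : M ∈ familySides) : ¬ Odd M := by
  rw [Nat.not_odd_iff_even]
  exact even_of_mem_familySides hM

/-- Track A's class is disjoint from the odd class. [folklore] -/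
theorem familySides_disjoint_odd : Disjoint familySides {M | Odd M} :=
  Set.disjoint_left.mpr fun _ hM hodd => not_odd_of_mem_familySides hM hodd

/-- Track A's class is unbounded: every demand `N` is met by a side `2·13^{1+K}` of the family of block size `13`. [folklore] -/
theorem familySides_unbounded (N : ℕ) : ∃ M ∈ familySides, N ≤ M := by
  -- a concrete family: block size `13` (odd, `> 11`), torus exponent `1`
  let F13 : T4Family := ⟨13, ⟨by decide, by norm_num⟩, by norm_num, 1, le_rfl⟩
  refine ⟨(F13.P N).sitesPerDir 0, ⟨F13, N, rfl⟩, ?_⟩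
  have h : (F13.P N).sitesPerDir 0 = 2 * 13 ^ (1 + N) := family_sitesPerDir_zero F13 N
  rw [h]
  have h13 : (1 : ℕ) < 13 := by norm_num
  calc N ≤ 13 ^ N := (Nat.lt_pow_self h13).le
    _ ≤ 13 ^ (1 + N) := Nat.pow_le_pow_right (by norm_num) (Nat.le_add_left _ _)
    _ ≤ 2 * 13 ^ (1 + N) := Nat.le_mul_of_pos_left _ two_pos

/-- No species scheme of the summit statement has its sides in Track A's class (`sch.side k = 2L_k+1` is odd). [folklore] -/
theorem speciesScheme_side_not_mem_familySides {ι : Type} (sch : SpeciesScheme ι) (k : ℕ) : sch.side k ∉ familySides :=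
  fun h => not_odd_of_mem_familySides h (speciesScheme_side_odd sch k)

/-! ## §4 The raw-torus expectation in the Literature's own symbols -/

/-- `torusEOn` IS the Literature's torus Wilson expectation of the periodic-lift observable: `torusEOn G r β M Φ =
wilsonExpectation (L := M) r.ρ β (toTorusObservable M Φ)` (definitionally) — the symbol of `IsInfiniteVolumeLimitAlong`, of the GaugeBoot
reflection-positivity lemmas and of the census's `wilsonTorusMean`-type wrappers; so no further raw-side «torus mean» needs defining. [folklore] -/
theorem torusEOn_eq_wilsonExpectation {G : Type} [Group G] [TopologicalSpace G] [IsTopologicalGroup G] [CompactSpace G]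
    [MeasurableSpace G] [BorelSpace G] (r : LatticeRep G) (β : ℝ) (M : ℕ) [NeZero M] (Φ : LGConfig 4 G → ℝ) :
    torusEOn G r β M Φ =
      wilsonExpectation (d := 4) (L := M) r.ρ β (Literature.MathematicalPhysics.QuantumLattice.toTorusObservable M Φ) := rfl

/-- The spine's `torusE` in the same symbols: `torusE G r β S Φ = wilsonExpectation (L := 2S+1) r.ρ β (toTorusObservable (2S+1) Φ)`. [folklore] -/
theorem torusE_eq_wilsonExpectation {G : Type} [Group G] [TopologicalSpace G] [IsTopologicalGroup G] [CompactSpace G]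
    [MeasurableSpace G] [BorelSpace G] (r : LatticeRep G) (β : ℝ) (S : ℕ) (Φ : LGConfig 4 G → ℝ) :
    Summit.QuantumFields.YangMills.Cruxes.OSLegsFromFemtoAndGap.DlrCollarTransfer.torusE G r β S Φ =
      wilsonExpectation (d := 4) (L := 2 * S + 1) r.ρ β
        (Literature.MathematicalPhysics.QuantumLattice.toTorusObservable (2 * S + 1) Φ) := rfl

end Summit.QuantumFields.YangMills.Cruxes.UV.TorusClass
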